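import Literature.NumberTheory.ComplexMultiplication.FaltingsTateOfPrimitiveCM
import Literature.NumberTheory.ComplexMultiplication.FaltingsTateOfDistinctCMFields
import Literature.AlgebraicGeometry.Motives.FaltingsTateFiniteBiproductAdditivity
import HarnessLib

/-!
# [Faltings 1983, §5 Kor. 1] for products of CM abelian varieties of PRIMITIVE types

Theorems only (topic `NumberTheory/ComplexMultiplication`; no definition, no named fact, no instance).
Sequel of `FaltingsTateOfPrimitiveCM` (ONE structure of primitive type: a scalar Frobenius generating
`K`, [Shimura1998, §13.2 Thm. 2, proof]) and of `FaltingsTateOfDistinctCMFields` /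
`FaltingsTateOfCMEllipticProducts` (two CM ELLIPTIC structures); generic additivity over finite
biproducts is `Motives/FaltingsTateFiniteBiproductAdditivity`.

Let `(A_i, ι_i : 𝓞_{K_i} → End A_i)`, `i ∈ ι` finite, be structures of CM types `(K_i, Φ_i)` over the
SAME number field `k ⊆ ℂ` (`IsCMTypeRealisationOver`), each `Φ_i` PRIMITIVE
(`IsPrimitive (ℂ ≃+* ℂ) Φ_i φ_i`, [Shimura1998, §8.2 Prop. 26]; any dimensions `g_i`).

§1 (feeder).  For ANY normal number field `L` receiving `k` and every `K_i`: ONE rational prime `p`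
splitting completely in `L`, ONE place `v ∣ p` of `k` prime to `ℓ` and ONE Frobenius `σ₀ ∈ Γ_k` at `v`
serve all the structures at once — `ρ_{A_i,ℓ}(σ₀) = T_ℓ(ι_i π_i)` with `(π_i) = N_{Ψ_i}(v)` the reflex
type norm (`exists_splitsCompletely_frobenius_isReflexTypeNorm_family`): the finitely many cofinite sets
of good places of [Shimura1998, §13.1 Thm. 1 (ii)] (★ `shimuraTaniyama_heckeCharactersST_eventually_of_thm18_6`,
granted [Shimura1998, Thm. 18.6]) meet the infinitely many completely split primes
(★ `NumberFields.infinite_setOf_splitsCompletely`).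
§2.  A normal hull of `k` and all the `K_i` inside `ℂ` (`normalClosure ⊔ ⨆ normalClosure`).
§3 (head).  ONE `σ₀` acts on every `T_ℓ A_i` as a scalar `T_ℓ(ι_i π_i)` with `ℚ(π_i) = K_i`
(`exists_common_tateRep_eq_of_isPrimitive_family`; structure by structure by ★
`adjoin_eq_top_of_isReflexTypeNorm_of_isPrimitive_of_splitsCompletely`, [Shimura1998, §13.2 Thm. 2, proof]).
§4.  Hence `faltings_tate_bijective (A_i) (A_{i'}) ℓ` for all `i, i'` when the `K_i` are pairwise
non-isomorphic (`faltings_tate_bijective_of_isPrimitive_family`): on the diagonal `ι(K)` is its own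
commutant ([SerreTate1968, §4], ★ `bijective_faltingsTateMap_of_isCMTypeRealisationOver_of_tateRep_eq`),
off the diagonal both sides vanish (★ `bijective_faltingsTateMap_of_tateRep_eq_of_aeval_ne_zero`).
§5.  **`faltings_tate_bijective A B ℓ` for every `A` isogenous to `⨁_s A_{c(s)}` and every `B` isogenous
to `⨁_t A_{d(t)}`** — arbitrary finite products of the structures with multiplicities
(`faltings_tate_bijective_of_isIsogenous_biproduct_of_isPrimitive_family`, by ★
`faltings_tate_bijective_of_isIsogenous_biproduct_biproduct`), and the «`A_i ⊗ ℂ` simple» rider.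
All granted [Shimura1998, Thm. 18.6] (`h186`; ★ `shimura1998_thm18_6_holds` discharges it Summits-side).
CM elliptic structures are the case `[K_i : ℚ] = 2` (every CM type of an imaginary quadratic field is
primitive), so this subsumes `FaltingsTateOfCMEllipticProducts` for families of any finite size.

## References

* [Faltings1983Endlichkeit] G. Faltings, Invent. Math. 73 (1983), §5 Korollar 1 (the statement decided).
* [Shimura1998] G. Shimura, *Abelian Varieties with Complex Multiplication and Modular Functions*
  (1998), §8.2 Prop. 26; §13.1 Thm. 1; §13.2 Thm. 2 (proof, pp. 100–101); §18.6 Thm. 18.6.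
* [SerreTate1968] J.-P. Serre, J. Tate, Ann. of Math. 88 (1968), §4 Theorem 5 and Corollary 1.
-/

noncomputable section

open scoped NumberField
open NumberField IsDedekindDomain CategoryTheory CategoryTheory.Limits
open Literature.AlgebraicGeometry.Motives Literature.AlgebraicGeometry.Motives.AbelianVariety
open Literature.NumberTheory.GaloisRepresentations
open scoped Pointwise IntermediateField

namespace Literature.NumberTheory.ComplexMultiplication

/-! ## §1 ONE good place for finitely many structures over `k` -/

/-- A nonzero prime of `𝓞 k` contains at most one rational prime. [folklore] -/
private theorem subsingleton_setOf_prime_natCast_mem_aux {k : Type} [Field k] [NumberField k]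
    (v : HeightOneSpectrum (𝓞 k)) : {p : ℕ | p.Prime ∧ (p : 𝓞 k) ∈ v.asIdeal}.Subsingleton := by
  intro p hp q hq
  by_contra hne
  have hcop : Nat.Coprime p q := (Nat.coprime_primes hp.1 hq.1).2 hne
  obtain ⟨a, b, hab⟩ := Nat.isCoprime_iff_coprime.2 hcop
  have h1 : (1 : 𝓞 k) ∈ v.asIdeal := by
    have : ((a * p + b * q : ℤ) : 𝓞 k) ∈ v.asIdeal := by
      push_cast
      exact v.asIdeal.add_mem (v.asIdeal.mul_mem_left _ hp.2) (v.asIdeal.mul_mem_left _ hq.2)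
    simpa [hab] using this
  exact v.isPrime.ne_top ((Ideal.eq_top_iff_one _).2 h1)

/-- Every rational prime lies below some finite place of `k`. [folklore] -/
private theorem exists_heightOneSpectrum_natCast_mem_aux {k : Type} [Field k] [NumberField k] {p : ℕ}
    (hp : p.Prime) : ∃ v : HeightOneSpectrum (𝓞 k), (p : 𝓞 k) ∈ v.asIdeal := by
  have hp0 : ((p : ℤ)) ≠ 0 := Int.natCast_ne_zero.2 hp.ne_zero
  haveI : (Ideal.span {(p : ℤ)}).IsMaximal :=
    ((Ideal.span_singleton_prime hp0).2 (Nat.prime_iff_prime_int.1 hp)).isMaximal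
      (by rwa [Ne, Ideal.span_singleton_eq_bot])
  obtain ⟨Q, hQmax, hQ⟩ := Ideal.exists_ideal_over_maximal_of_isIntegral (S := 𝓞 k) (Ideal.span {(p : ℤ)})
    (by rw [(RingHom.injective_iff_ker_eq_bot _).1 (algebraMap ℤ (𝓞 k)).injective_int]; exact bot_le)
  have hpQ : (p : 𝓞 k) ∈ Q := by
    have : algebraMap ℤ (𝓞 k) (p : ℤ) ∈ Q := by
      rw [← Ideal.mem_comap, hQ]; exact Ideal.mem_span_singleton_self _
    simpa only [map_natCast] using this
  have hQ0 : Q ≠ ⊥ := by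
    rintro rfl
    rw [Ideal.comap_bot_of_injective _ (algebraMap ℤ (𝓞 k)).injective_int] at hQ
    exact hp0 (Ideal.span_singleton_eq_bot.1 hQ.symm)
  exact ⟨⟨Q, hQmax.isPrime, hQ0⟩, hpQ⟩

/-- **Family feeder.**  For finitely many structures `(A_i, ι_i)` of types `(K_i, Φ_i)` over the SAME number
field `k`, a prime `ℓ` and ANY normal number field `L` receiving every `K_i` (`j_i`) and `k` (`σL`, compatibly with
`k ⊆ ℂ` along `ιL`): some rational prime `p` splitting completely in `L`, a place `v ∣ p` of `k` prime to `ℓ` and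
ONE Frobenius `σ₀ ∈ Γ_k` at `v` such that, for every `i`, some `π_i ∈ 𝓞_{K_i}` has `ρ_{A_i,ℓ}(σ₀) = T_ℓ(ι_i π_i)`
and `(π_i) =` the reflex type norm of `v` for `(Φ_i)_L` — the finitely many cofinite sets of good places of
★ `shimuraTaniyama_heckeCharactersST_eventually_of_thm18_6` meet the infinite set of completely split primes
(★ `NumberFields.infinite_setOf_splitsCompletely`); the one-structure case is ★
`exists_splitsCompletely_frobenius_isReflexTypeNorm`.  Granted [Shimura1998, Thm. 18.6] (`h186`).
[cite: Shimura1998, §13.1 Thm. 1 (ii) and §18.6 Thm. 18.6] -/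
theorem exists_splitsCompletely_frobenius_isReflexTypeNorm_family (h186 : shimura1998_thm18_6)
    {k : Type} [Field k] [NumberField k] [Algebra k ℂ] {ι : Type} [Finite ι]
    {K : ι → Type} [∀ i, Field (K i)] [∀ i, NumberField (K i)] [∀ i, IsCMField (K i)]
    (Φ : ∀ i, CMType (K i)) (A : ι → AbelianVariety k) (ιA : ∀ i, 𝓞 (K i) →+* CategoryTheory.End (A i))
    (hA : ∀ i, IsCMTypeRealisationOver (Φ i) (A i) (ιA i)) (ℓ : ℕ) [Fact ℓ.Prime]
    (L : Type) [Field L] [NumberField L] [Normal ℚ L] (ιL : L →+* ℂ) (j : ∀ i, K i →+* L) (σL : k →+* L)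
    (hcomp : ιL.comp σL = algebraMap k ℂ) :
    ∃ (p : ℕ) (v : HeightOneSpectrum (𝓞 k)) (σ₀ : Field.absoluteGaloisGroup k),
      p.Prime ∧ SplitsCompletely L p ∧ (p : 𝓞 k) ∈ v.asIdeal ∧ (ℓ : 𝓞 k) ∉ v.asIdeal ∧
      ∀ i, ∃ π : 𝓞 (K i), (A i).tateRep ℓ σ₀ = tateModuleMap ℓ (ιA i π : A i ⟶ A i) ∧
        IsReflexTypeNorm (valuedIn ιL (Φ i).1) (j i) σL v.asIdeal (Ideal.span {π}) := by
  classical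
  -- (5ST) at cofinitely many places, for each structure
  have hev : ∀ i, ∃ S : Set (HeightOneSpectrum (𝓞 k)), S.Finite ∧ ∀ v ∉ S, ∃ π : 𝓞 (K i),
      (∀ (ℓ : ℕ) [Fact ℓ.Prime], (ℓ : 𝓞 k) ∉ v.asIdeal →
        ∀ 𝔓 ∈ v.primesAbove, ∀ σ : Field.absoluteGaloisGroup k, IsArithFrobAt (𝓞 k) σ 𝔓 →
          (A i).tateRep ℓ σ = tateModuleMap ℓ (ιA i π : A i ⟶ A i)) ∧
      (∀ (L : Type) [Field L] [NumberField L] [Normal ℚ L] (ιL : L →+* ℂ) (j : K i →+* L)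
        (σL : k →+* L), ιL.comp σL = algebraMap k ℂ →
          IsReflexTypeNorm (valuedIn ιL (Φ i).1) j σL v.asIdeal (Ideal.span {π})) := fun i => by
    obtain ⟨χ, -, -, -, hev⟩ :=
      shimuraTaniyama_heckeCharactersST_eventually_of_thm18_6 h186 k (K i) (Φ i) (A i) (ιA i) (hA i)
    refine ⟨_, Filter.eventually_cofinite.1 hev, fun v hv => ?_⟩
    simp only [Set.mem_setOf_eq, not_not] at hv
    obtain ⟨π, -, hfrob, hrefl⟩ := hv
    exact ⟨π, hfrob, hrefl⟩
  choose S hSfin hS using hev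
  -- the bad rational primes: `ℓ` and the residue characteristics of the exceptional places of all structures
  set Bad : Set ℕ := {ℓ} ∪ ⋃ i, ⋃ v ∈ S i, {p : ℕ | p.Prime ∧ (p : 𝓞 k) ∈ v.asIdeal} with hBad
  have hBadfin : Bad.Finite :=
    (Set.finite_singleton ℓ).union (Set.finite_iUnion fun i =>
      (hSfin i).biUnion fun v _ => (subsingleton_setOf_prime_natCast_mem_aux v).finite)
  obtain ⟨p, ⟨hp, hsplit⟩, hpBad⟩ :=
    ((Literature.NumberTheory.NumberFields.infinite_setOf_splitsCompletely L).sdiff hBadfin).nonempty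
  obtain ⟨v, hpv⟩ := exists_heightOneSpectrum_natCast_mem_aux (k := k) hp
  -- `v` is good for every structure, and prime to `ℓ`
  have hvgood : ∀ i, v ∉ S i := fun i hv =>
    hpBad (Or.inr (Set.mem_iUnion.2 ⟨i, Set.mem_biUnion hv ⟨hp, hpv⟩⟩))
  have hℓv : (ℓ : 𝓞 k) ∉ v.asIdeal := fun hℓ =>
    hpBad (Or.inl (subsingleton_setOf_prime_natCast_mem_aux v ⟨hp, hpv⟩ ⟨Fact.out, hℓ⟩))
  -- one Frobenius at `v`
  obtain ⟨𝔓, h𝔓⟩ := v.primesAbove_nonempty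
  obtain ⟨σ₀, hσ₀⟩ :=
    IsDedekindDomain.HeightOneSpectrum.exists_isArithFrobAt_of_mem_primesAbove_holds (v := v) h𝔓
  refine ⟨p, v, σ₀, hp, hsplit, hpv, hℓv, fun i => ?_⟩
  obtain ⟨π, hfrob, hrefl⟩ := hS i v (hvgood i)
  exact ⟨π, hfrob ℓ hℓv 𝔓 h𝔓 σ₀ hσ₀, hrefl L ιL (j i) σL hcomp⟩

/-! ## §2 A normal hull of `k` and finitely many `K_i` inside `ℂ` -/

/-- **A finite normal subextension `L ⊆ ℂ` of `ℚ` containing `k` (along its structure map) and a copy of every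
`K_i`** (`i` in a finite index type): `L := normalClosure ℚ k ℂ ⊔ ⨆_i normalClosure ℚ (K_i) ℂ` — Shimura's
«Taking a Galois extension `L` of **Q** containing `K`» for several `K` at once. [folklore] -/
private theorem exists_normal_intermediateField_complex_family (k : Type) [Field k] [NumberField k]
    [Algebra k ℂ] {ι : Type} [Finite ι] (K : ι → Type) [∀ i, Field (K i)] [∀ i, NumberField (K i)] :
    ∃ L : IntermediateField ℚ ℂ, FiniteDimensional ℚ L ∧ Normal ℚ L ∧
      (∀ x : k, algebraMap k ℂ x ∈ L) ∧ ∀ i, ∃ τ : K i →+* ℂ, ∀ y : K i, τ y ∈ L := by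
  have τ : ∀ i, K i →+* ℂ := fun i => Classical.choice (NumberField.Embeddings.instNonemptyRingHom (K i) ℂ)
  haveI h1 : IsNormalClosure ℚ k (IntermediateField.normalClosure ℚ k ℂ) :=
    Algebra.IsAlgebraic.isNormalClosure_normalClosure fun x => IsAlgClosed.splits _
  haveI h2 : ∀ i, IsNormalClosure ℚ (K i) (IntermediateField.normalClosure ℚ (K i) ℂ) := fun i =>
    Algebra.IsAlgebraic.isNormalClosure_normalClosure fun x => IsAlgClosed.splits _
  have hN1 : Normal ℚ (IntermediateField.normalClosure ℚ k ℂ) := IsNormalClosure.normal (K := k)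
  have hN2 : ∀ i, Normal ℚ (IntermediateField.normalClosure ℚ (K i) ℂ) := fun i =>
    IsNormalClosure.normal (K := K i)
  have hN3 : Normal ℚ (⨆ i, IntermediateField.normalClosure ℚ (K i) ℂ : IntermediateField ℚ ℂ) :=
    IntermediateField.normal_iSup (h := hN2) _
  refine ⟨IntermediateField.normalClosure ℚ k ℂ ⊔ ⨆ i, IntermediateField.normalClosure ℚ (K i) ℂ,
    IntermediateField.finiteDimensional_sup _ _,
    @IntermediateField.normal_sup ℚ ℂ _ _ _ _ _ hN1 hN3, fun x => ?_, fun i => ⟨τ i, fun y => ?_⟩⟩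
  · exact SetLike.le_def.1 (le_sup_left : IntermediateField.normalClosure ℚ k ℂ ≤ _)
      (AlgHom.fieldRange_le_normalClosure (IsScalarTower.toAlgHom ℚ k ℂ) ⟨x, rfl⟩)
  · refine SetLike.le_def.1 (le_sup_right : (⨆ i, IntermediateField.normalClosure ℚ (K i) ℂ) ≤ _) ?_
    exact SetLike.le_def.1 (le_iSup (fun i => IntermediateField.normalClosure ℚ (K i) ℂ) i)
      (AlgHom.fieldRange_le_normalClosure (τ i).toRatAlgHom ⟨y, rfl⟩)

/-! ## §3 ONE scalar Frobenius for finitely many primitive structures, generating every `K_i` -/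

/-- **ONE common scalar Frobenius for finitely many structures of PRIMITIVE CM type** over the same number
field `k` (any dimensions `g_i`): for every prime `ℓ` some `σ₀ ∈ Γ_k` acts on each `T_ℓ A_i` as `T_ℓ(ι_i π_i)`
with `ℚ(π_i) = K_i` — ONE completely split rational prime below ONE place `v` of `k` good for all the
Shimura–Taniyama descriptions (`exists_splitsCompletely_frobenius_isReflexTypeNorm_family` over the normal hull
of §2), then [Shimura1998, §13.2 Thm. 2, proof] structure by structure (★
`adjoin_eq_top_of_isReflexTypeNorm_of_isPrimitive_of_splitsCompletely`, with the ★ glue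
`isPrimitive_valuedIn_of_isPrimitive_complex` / `stabilizer_le_stabilizer_valuedIn`); the one-structure case is
★ `exists_tateRep_eq_tateModuleMap_and_adjoin_eq_top_of_isPrimitive`.  Granted [Shimura1998, Thm. 18.6] (`h186`).
[cite: Shimura1998, §13.2 Thm. 2 (proof) with §13.1 Thm. 1 (ii) and §8.2 Prop. 26; §18.6 Thm. 18.6] -/
theorem exists_common_tateRep_eq_of_isPrimitive_family (h186 : shimura1998_thm18_6)
    {k : Type} [Field k] [NumberField k] [Algebra k ℂ] {ι : Type} [Finite ι]
    {K : ι → Type} [∀ i, Field (K i)] [∀ i, NumberField (K i)] [∀ i, IsCMField (K i)]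
    (Φ : ∀ i, CMType (K i)) (A : ι → AbelianVariety k) (ιA : ∀ i, 𝓞 (K i) →+* CategoryTheory.End (A i))
    (hA : ∀ i, IsCMTypeRealisationOver (Φ i) (A i) (ιA i)) {φ₀ : ∀ i, K i →+* ℂ}
    (hprim : ∀ i, IsPrimitive (ℂ ≃+* ℂ) (Φ i).1 (φ₀ i)) (ℓ : ℕ) [Fact ℓ.Prime] :
    ∃ σ₀ : Field.absoluteGaloisGroup k, ∀ i, ∃ π : 𝓞 (K i),
      (A i).tateRep ℓ σ₀ = tateModuleMap ℓ (ιA i π : A i ⟶ A i) ∧ ℚ⟮(π : K i)⟯ = ⊤ := by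
  obtain ⟨L, hfd, hnorm, hk, hK⟩ := exists_normal_intermediateField_complex_family k K
  choose τ hτ using hK
  haveI : FiniteDimensional ℚ L := hfd
  haveI : Normal ℚ L := hnorm
  haveI : NumberField L := NumberField.of_module_finite ℚ L
  haveI : IsGalois ℚ L := ⟨⟩
  let ιL : L →+* ℂ := algebraMap L ℂ
  let σL : k →+* L := (algebraMap k ℂ).codRestrict L hk
  let j : ∀ i, K i →+* L := fun i => (τ i).codRestrict L (hτ i)
  have hcomp : ιL.comp σL = algebraMap k ℂ := RingHom.ext fun _ => rfl
  obtain ⟨p, v, σ₀, hp, hsplit, hpv, -, hall⟩ :=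
    exists_splitsCompletely_frobenius_isReflexTypeNorm_family h186 Φ A ιA hA ℓ L ιL j σL hcomp
  refine ⟨σ₀, fun i => ?_⟩
  obtain ⟨π, hσ₀, hrefl⟩ := hall i
  exact ⟨π, hσ₀, adjoin_eq_top_of_isReflexTypeNorm_of_isPrimitive_of_splitsCompletely (valuedIn ιL (Φ i).1)
    (j i) σL (isPrimitive_valuedIn_of_isPrimitive_complex ιL (Φ i) (hprim i) (j i))
    (stabilizer_le_stabilizer_valuedIn ιL (Φ i) (hA i) σL hcomp) hp hsplit v hpv hrefl⟩

/-! ## §4 [Fal83 §5 Kor. 1] for the factors, pairwise -/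

/-- If `ℚ(π₁) = K₁`, `ℚ(π₂) = K₂` and `K₁ ≄ K₂` then `π₂` is not a root of `minpoly_ℤ(π₁)` (otherwise the two
monic irreducible minimal polynomials over `ℚ` coincide and `K₁ ≅ ℚ[X]/(m) ≅ K₂`); the private lemma of ★
`FaltingsTateOfDistinctCMFields` §3, repeated for self-containedness. [folklore] -/
private theorem aeval_minpoly_ne_zero_of_isEmpty_algEquiv_aux
    {K₁ K₂ : Type} [Field K₁] [NumberField K₁] [Field K₂] [NumberField K₂]
    (π₁ : 𝓞 K₁) (π₂ : 𝓞 K₂) (hπ₁ : ℚ⟮(π₁ : K₁)⟯ = ⊤) (hπ₂ : ℚ⟮(π₂ : K₂)⟯ = ⊤)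
    (hK : IsEmpty (K₁ ≃ₐ[ℚ] K₂)) : Polynomial.aeval π₂ (minpoly ℤ π₁) ≠ 0 := by
  intro h
  have hπ₁Q : IsIntegral ℚ (π₁ : K₁) := (NumberField.RingOfIntegers.isIntegral_coe π₁).tower_top
  have hπ₂Q : IsIntegral ℚ (π₂ : K₂) := (NumberField.RingOfIntegers.isIntegral_coe π₂).tower_top
  set m : Polynomial ℚ := minpoly ℚ (π₁ : K₁) with hm
  have hmZ : m = (minpoly ℤ π₁).map (algebraMap ℤ ℚ) := by
    rw [hm, ← NumberField.RingOfIntegers.minpoly_coe π₁]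
    exact minpoly.isIntegrallyClosed_eq_field_fractions' ℚ (NumberField.RingOfIntegers.isIntegral_coe π₁)
  have hroot : Polynomial.aeval (π₂ : K₂) m = 0 := by
    rw [hmZ, Polynomial.aeval_map_algebraMap, NumberField.RingOfIntegers.coe_eq_algebraMap,
      Polynomial.aeval_algebraMap_apply, h, map_zero]
  have hm₂ : m = minpoly ℚ (π₂ : K₂) :=
    minpoly.eq_of_irreducible_of_monic (minpoly.irreducible hπ₁Q) hroot (minpoly.monic hπ₁Q)
  have e₁ : K₁ ≃ₐ[ℚ] AdjoinRoot m :=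
    (((IntermediateField.equivOfEq hπ₁).trans IntermediateField.topEquiv).symm.trans
      (IntermediateField.adjoinRootEquivAdjoin ℚ hπ₁Q).symm)
  have e₂ : AdjoinRoot m ≃ₐ[ℚ] K₂ := by
    rw [hm₂]
    exact (IntermediateField.adjoinRootEquivAdjoin ℚ hπ₂Q).trans
      ((IntermediateField.equivOfEq hπ₂).trans IntermediateField.topEquiv)
  exact hK.false (e₁.trans e₂)

/-- **[Fal83 §5 Kor. 1] for every PAIR of factors of a finite family of primitive CM structures with pairwise
non-isomorphic CM fields** over the same `k` (`k ⊆ ℂ`; the predicate quantifies over `[NumberField k]`), granted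
[Shimura1998, Thm. 18.6]: `faltings_tate_bijective (A i) (A i') ℓ` — on the diagonal `ι(K)` is its own commutant
(★ `bijective_faltingsTateMap_of_isCMTypeRealisationOver_of_tateRep_eq`), off the diagonal both sides vanish
(★ `bijective_faltingsTateMap_of_tateRep_eq_of_aeval_ne_zero`), the ONE common scalar Frobenius coming from
`exists_common_tateRep_eq_of_isPrimitive_family`.
[cite: Faltings1983Endlichkeit, §5 Korollar 1] [cite: SerreTate1968, §4 Theorem 5 and Corollary 1]
[cite: Shimura1998, §13.2 Thm. 2 (proof) and §18.6 Thm. 18.6] -/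
theorem faltings_tate_bijective_of_isPrimitive_family (h186 : shimura1998_thm18_6)
    {k : Type} [Field k] [Algebra k ℂ] {ι : Type} [Finite ι]
    {K : ι → Type} [∀ i, Field (K i)] [∀ i, NumberField (K i)] [∀ i, IsCMField (K i)]
    (Φ : ∀ i, CMType (K i)) (A : ι → AbelianVariety k) (ιA : ∀ i, 𝓞 (K i) →+* CategoryTheory.End (A i))
    (hA : ∀ i, IsCMTypeRealisationOver (Φ i) (A i) (ιA i)) {φ₀ : ∀ i, K i →+* ℂ}
    (hprim : ∀ i, IsPrimitive (ℂ ≃+* ℂ) (Φ i).1 (φ₀ i)) (hK : ∀ i i', i ≠ i' → IsEmpty (K i ≃ₐ[ℚ] K i'))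
    (ℓ : ℕ) [Fact ℓ.Prime] (i i' : ι) : faltings_tate_bijective (A i) (A i') ℓ := by
  intro _
  obtain ⟨σ₀, hσ₀⟩ := exists_common_tateRep_eq_of_isPrimitive_family h186 Φ A ιA hA hprim ℓ
  obtain ⟨π, hπσ, hπ⟩ := hσ₀ i
  by_cases hii' : i = i'
  · subst hii'
    exact bijective_faltingsTateMap_of_isCMTypeRealisationOver_of_tateRep_eq (Φ i) (A i) (ιA i) (hA i) ℓ
      σ₀ π hπσ hπ
  · obtain ⟨π', hπ'σ, hπ'⟩ := hσ₀ i'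
    exact bijective_faltingsTateMap_of_tateRep_eq_of_aeval_ne_zero (A i) (A i') (ιA i) (ιA i') ℓ σ₀ π π'
      hπσ hπ'σ (aeval_minpoly_ne_zero_of_isEmpty_algEquiv_aux π π' hπ hπ' (hK i i' hii'))

/-! ## §5 [Fal83 §5 Kor. 1] for products of the structures and their isogeny classes -/

/-- **[Fal83 §5 Kor. 1] for arbitrary finite products, with multiplicities, of primitive CM structures with
pairwise non-isomorphic CM fields, and their isogeny classes** — granted [Shimura1998, Thm. 18.6]: for index
maps `c : S → ι`, `d : T → ι` (finite `S`, `T`), every `A` isogenous to `⨁_s A_{c s}` and every `B` isogenous to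
`⨁_t A_{d t}` satisfy `faltings_tate_bijective A B ℓ` (pairwise corners `faltings_tate_bijective_of_isPrimitive_family`,
then ★ `faltings_tate_bijective_of_isIsogenous_biproduct_biproduct`).  With `ι = Fin 2` and `[K_i : ℚ] = 2` this is
★ `faltings_tate_bijective_of_isIsogenous_prod_of_distinct_CM_elliptic_of_thm18_6`.
[cite: Faltings1983Endlichkeit, §5 Korollar 1 and §5 ¶1] [cite: Shimura1998, §13.2 Thm. 2 (proof) and §18.6 Thm. 18.6] -/
theorem faltings_tate_bijective_of_isIsogenous_biproduct_of_isPrimitive_family (h186 : shimura1998_thm18_6)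
    {k : Type} [Field k] [Algebra k ℂ] {ι : Type} [Finite ι]
    {K : ι → Type} [∀ i, Field (K i)] [∀ i, NumberField (K i)] [∀ i, IsCMField (K i)]
    (Φ : ∀ i, CMType (K i)) (A : ι → AbelianVariety k) (ιA : ∀ i, 𝓞 (K i) →+* CategoryTheory.End (A i))
    (hA : ∀ i, IsCMTypeRealisationOver (Φ i) (A i) (ιA i)) {φ₀ : ∀ i, K i →+* ℂ}
    (hprim : ∀ i, IsPrimitive (ℂ ≃+* ℂ) (Φ i).1 (φ₀ i)) (hK : ∀ i i', i ≠ i' → IsEmpty (K i ≃ₐ[ℚ] K i'))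
    (ℓ : ℕ) [Fact ℓ.Prime] {S T : Type} [Fintype S] [Fintype T] (c : S → ι) (d : T → ι)
    {A' B' : AbelianVariety k} (hA' : IsIsogenous (⨁ fun s => A (c s)) A')
    (hB' : IsIsogenous (⨁ fun t => A (d t)) B') : faltings_tate_bijective A' B' ℓ :=
  faltings_tate_bijective_of_isIsogenous_biproduct_biproduct ℓ _ _ hA' hB' fun s t =>
    faltings_tate_bijective_of_isPrimitive_family h186 Φ A ιA hA hprim hK ℓ (c s) (d t)

/-- **The same for the plain product `⨁_i A_i` against itself** (each structure once: `c = d = id`), e.g. the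
`End` form of [Fal83 §5 Satz 4] for `A ~ ∏_i A_i`. [cite: Faltings1983Endlichkeit, §5 Satz 4 and Korollar 1]
[cite: Shimura1998, §13.2 Thm. 2 (proof) and §18.6 Thm. 18.6] -/
theorem faltings_tate_bijective_of_isIsogenous_biproduct_self_of_isPrimitive_family (h186 : shimura1998_thm18_6)
    {k : Type} [Field k] [Algebra k ℂ] {ι : Type} [Fintype ι]
    {K : ι → Type} [∀ i, Field (K i)] [∀ i, NumberField (K i)] [∀ i, IsCMField (K i)]
    (Φ : ∀ i, CMType (K i)) (A : ι → AbelianVariety k) (ιA : ∀ i, 𝓞 (K i) →+* CategoryTheory.End (A i))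
    (hA : ∀ i, IsCMTypeRealisationOver (Φ i) (A i) (ιA i)) {φ₀ : ∀ i, K i →+* ℂ}
    (hprim : ∀ i, IsPrimitive (ℂ ≃+* ℂ) (Φ i).1 (φ₀ i)) (hK : ∀ i i', i ≠ i' → IsEmpty (K i ≃ₐ[ℚ] K i'))
    (ℓ : ℕ) [Fact ℓ.Prime] {A' B' : AbelianVariety k} (hA' : IsIsogenous (⨁ A) A') (hB' : IsIsogenous (⨁ A) B') :
    faltings_tate_bijective A' B' ℓ :=
  faltings_tate_bijective_of_isIsogenous_biproduct_of_isPrimitive_family h186 Φ A ιA hA hprim hK ℓ id id hA' hB'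

/-! ## §6 Rider: «`A_i ⊗ ℂ` simple» in place of «`Φ_i` primitive» ([Shimura1998, §8.2 Prop. 26]) -/

/-- **[Fal83 §5 Kor. 1] for finite products of SIMPLE CM abelian varieties with pairwise non-isomorphic CM
fields and their isogeny classes**, granted [Shimura1998, Thm. 18.6] (simplicity of `A_i ⊗ ℂ` ⇒ primitivity of
`Φ_i`, ★ `isPrimitive_of_isSimple_baseChange`). [cite: Faltings1983Endlichkeit, §5 Korollar 1]
[cite: Shimura1998, §8.2 Prop. 26, §13.2 Thm. 2 (proof) and §18.6 Thm. 18.6] -/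
theorem faltings_tate_bijective_of_isIsogenous_biproduct_of_isSimple_family (h186 : shimura1998_thm18_6)
    {k : Type} [Field k] [Algebra k ℂ] {ι : Type} [Finite ι]
    {K : ι → Type} [∀ i, Field (K i)] [∀ i, NumberField (K i)] [∀ i, IsCMField (K i)]
    (Φ : ∀ i, CMType (K i)) (A : ι → AbelianVariety k) (ιA : ∀ i, 𝓞 (K i) →+* CategoryTheory.End (A i))
    (hA : ∀ i, IsCMTypeRealisationOver (Φ i) (A i) (ιA i)) (hS : ∀ i, ((A i).baseChange ℂ).IsSimple)
    (hK : ∀ i i', i ≠ i' → IsEmpty (K i ≃ₐ[ℚ] K i'))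
    (ℓ : ℕ) [Fact ℓ.Prime] {S T : Type} [Fintype S] [Fintype T] (c : S → ι) (d : T → ι)
    {A' B' : AbelianVariety k} (hA' : IsIsogenous (⨁ fun s => A (c s)) A')
    (hB' : IsIsogenous (⨁ fun t => A (d t)) B') : faltings_tate_bijective A' B' ℓ :=
  have φ₀ : ∀ i, K i →+* ℂ := fun i => Classical.choice (NumberField.Embeddings.instNonemptyRingHom (K i) ℂ)
  faltings_tate_bijective_of_isIsogenous_biproduct_of_isPrimitive_family h186 Φ A ιA hA
    (fun i => isPrimitive_of_isSimple_baseChange (Φ i) (hA i) (hS i) (φ₀ i)) hK ℓ c d hA' hB'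

end Literature.NumberTheory.ComplexMultiplication

end
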